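import Summits.Ventures.PercRepro.Night2ExcessMassIndep
import Summits.Ventures.PercRepro.Night2SeriesClasses
import Summits.Ventures.PercRepro.Night2GeneralQPoly

/-!
# PercRepro — the arithmetic of the cell `(2, 1)` at every size (night-2, gen 24)

The cell `(2, 1)` of the `(7, 5)` shadow row (`|E ∖ G| = 2`, `1` coloop(s), `ρ = 5`, `capDG = 11 / 18`) has no bound
on `n = |G ∖ K|`.  Size-uniform arithmetic of its count assembly (the pattern of `Night2ThreeTwoArith`):

* the chord of `1/(m + 2)` on `[2, n − 4]`: `a = (n : ℚ) / (4 * ((n : ℚ) - 2))`, `b = 1 / (4 * ((n : ℚ) - 2))` (`chord_twoone`), the excess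
  `excessBound 5 2 5 1 n a b = (19 * (n : ℚ) + 193) / (72 * ((n : ℚ) - 2))` (`excessBound_twoone_eq`);
* the one-fat-pair count `cntSeries 5 s [2] = C(s−2, 3) + 2·C(s−2, 4)`, positive for `s ≥ 5`, at most `C(s, 5)`;
* the tail: `countSum n 5 4 (13 / 216) E (cntSeries 5 · [2]) ≥ 1` for `n ≥ 30` from the single middle term
  `j = ⌊(n−5)/2⌋` (`countSum_twoone_tail`; the induction `tail_twoone_aux`).
-/

namespace PercRepro.Shadow

open Finset PerFlat ThmH

/-- The chord of `1/(m + 2)` on `[2, n − 4]`. -/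
theorem chord_twoone {n : ℕ} (hn : 9 ≤ n) : ∀ m : ℕ, 2 ≤ m → m ≤ n - 5 + 1 →
    1 / ((m : ℚ) + ((2 : ℕ) : ℚ)) ≤ (n : ℚ) / (4 * ((n : ℚ) - 2)) - (1 / (4 * ((n : ℚ) - 2))) * (m : ℚ) := by
  intro m h1 h2
  have hm : (m : ℚ) ≤ (n : ℚ) - 4 := by
    have h3 : m + 4 ≤ n := by omega
    have h3' : ((m + 4 : ℕ) : ℚ) ≤ (n : ℚ) := by exact_mod_cast h3
    push_cast at h3'
    linarith
  have hm2 : (2 : ℚ) ≤ (m : ℚ) := by exact_mod_cast h1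
  have hn' : (9 : ℚ) ≤ (n : ℚ) := by exact_mod_cast hn
  have hpos : (0 : ℚ) < (m : ℚ) + ((2 : ℕ) : ℚ) := by push_cast; linarith
  have hN : (0 : ℚ) < ((n : ℚ) - 2) := by linarith
  rw [div_le_iff₀ hpos]
  have : (n : ℚ) / (4 * ((n : ℚ) - 2)) - (1 / (4 * ((n : ℚ) - 2))) * (m : ℚ) = (((n : ℚ) - 2) + 2 - m) / (4 * ((n : ℚ) - 2)) := by
    field_simp
    ring
  rw [this, div_mul_eq_mul_div, le_div_iff₀ (by positivity)]
  push_cast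
  nlinarith [mul_nonneg (sub_nonneg.2 hm2) (sub_nonneg.2 hm)]

/-- `excessBound 5 2 5 1 n a b = (19 * (n : ℚ) + 193) / (72 * ((n : ℚ) - 2))`. -/
theorem excessBound_twoone_eq {n : ℕ} (hn : 9 ≤ n) :
    excessBound 5 2 5 1 n ((n : ℚ) / (4 * ((n : ℚ) - 2))) (1 / (4 * ((n : ℚ) - 2))) = (19 * (n : ℚ) + 193) / (72 * ((n : ℚ) - 2)) := by
  have hn' : (9 : ℚ) ≤ (n : ℚ) := by exact_mod_cast hn
  have h3 : ((n : ℚ) - 2) ≠ 0 := by linarith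
  unfold excessBound capDG phiQ
  field_simp
  ring

/-- The excess is positive. -/
theorem excess_twoone_pos {n : ℕ} (hn : 9 ≤ n) : (0 : ℚ) < (19 * (n : ℚ) + 193) / (72 * ((n : ℚ) - 2)) := by
  have hn' : (9 : ℚ) ≤ (n : ℚ) := by exact_mod_cast hn
  apply div_pos <;> linarith

/-- The one-fat-pair count: `cntSeries 5 s [2] = C(s−2, 3) + 2·C(s−2, 4)`. -/
theorem cntSeries_twoone_eq (s : ℕ) : cntSeries 5 s [2] = (s - 2).choose 3 + 2 * (s - 2).choose 4 := by
  simp [cntSeries]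

/-- `cntSeries 5 s [2] > 0` for `s ≥ 5`. -/
theorem cntSeries_twoone_pos {s : ℕ} (hs : 5 ≤ s) : 0 < (cntSeries 5 s [2] : ℚ) := by
  rw [cntSeries_twoone_eq]
  have : 0 < (s - 2).choose 3 := Nat.choose_pos (by omega)
  exact_mod_cast (by omega : 0 < (s - 2).choose 3 + 2 * (s - 2).choose 4)

/-- `cntSeries 5 s [2] ≤ C(s, 5)`. -/
theorem cntSeries_twoone_le_choose {s : ℕ} (hs : 2 ≤ s) : cntSeries 5 s [2] ≤ s.choose 5 := by
  rw [cntSeries_twoone_eq]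
  obtain ⟨r, rfl⟩ : ∃ r, s = r + 2 := ⟨s - 2, by omega⟩
  simp only [Nat.add_sub_cancel]
  have h1 : (r + 2).choose 5 = (r + 1).choose 4 + (r + 1).choose 5 := Nat.choose_succ_succ (r + 1) 4
  have h2 : (r + 1).choose 5 = r.choose 4 + r.choose 5 := Nat.choose_succ_succ r 4
  have h3 : (r + 1).choose 4 = r.choose 3 + r.choose 4 := Nat.choose_succ_succ r 3
  omega

/-- The algebraic step of the tail induction (binomials abstracted). -/
theorem tail_twoone_step (m : ℕ) (C C' P : ℚ) (hC0 : 0 ≤ C)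
    (hC : C' * ((m : ℚ) + 26) = ((m : ℚ) + 31) * C)
    (ih : 3 * ((m : ℚ) + 26) * (19 * (m : ℚ) + 763) * C ≤ 13 * P * ((m : ℚ) + 28)) :
    3 * ((m : ℚ) + 27) * (19 * (m : ℚ) + 782) * C' ≤ 13 * (2 * P) * ((m : ℚ) + 29) := by
  have hm : (0 : ℚ) ≤ (m : ℚ) := Nat.cast_nonneg m
  have hpoly : ((m : ℚ) + 27) * (19 * (m : ℚ) + 782) * ((m : ℚ) + 31) * ((m : ℚ) + 28) ≤ 2 * ((m : ℚ) + 29) * ((m : ℚ) + 26) * ((m : ℚ) + 26) * (19 * (m : ℚ) + 763) := by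
    have e : 2 * ((m : ℚ) + 29) * ((m : ℚ) + 26) * ((m : ℚ) + 26) * (19 * (m : ℚ) + 763) - ((m : ℚ) + 27) * (19 * (m : ℚ) + 782) * ((m : ℚ) + 31) * ((m : ℚ) + 28) =
        19 * (m : ℚ) ^ 4 + 2188 * (m : ℚ) ^ 3 + 92587 * (m : ℚ) ^ 2 + 1707950 * (m : ℚ) + 11588752 := by ring
    have : 0 ≤ 19 * (m : ℚ) ^ 4 + 2188 * (m : ℚ) ^ 3 + 92587 * (m : ℚ) ^ 2 + 1707950 * (m : ℚ) + 11588752 := by positivity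
    linarith
  have h1 : 0 ≤ 3 * C * (2 * ((m : ℚ) + 29) * ((m : ℚ) + 26) * ((m : ℚ) + 26) * (19 * (m : ℚ) + 763) -
      ((m : ℚ) + 27) * (19 * (m : ℚ) + 782) * ((m : ℚ) + 31) * ((m : ℚ) + 28)) :=
    mul_nonneg (mul_nonneg (by norm_num) hC0) (sub_nonneg.2 hpoly)
  have h2 : 0 ≤ 2 * ((m : ℚ) + 29) * ((m : ℚ) + 26) * (13 * P * ((m : ℚ) + 28) - 3 * ((m : ℚ) + 26) * (19 * (m : ℚ) + 763) * C) :=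
    mul_nonneg (by positivity) (sub_nonneg.2 ih)
  have hpos : (0 : ℚ) < ((m : ℚ) + 26) * ((m : ℚ) + 28) := by positivity
  refine le_of_mul_le_mul_right ?_ hpos
  have e : 3 * ((m : ℚ) + 27) * (19 * (m : ℚ) + 782) * C' * (((m : ℚ) + 26) * ((m : ℚ) + 28)) =
      3 * ((m : ℚ) + 27) * (19 * (m : ℚ) + 782) * (C' * ((m : ℚ) + 26)) * ((m : ℚ) + 28) := by ring
  rw [e, hC]
  have key : 13 * (2 * P) * ((m : ℚ) + 29) * (((m : ℚ) + 26) * ((m : ℚ) + 28)) -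
      3 * ((m : ℚ) + 27) * (19 * (m : ℚ) + 782) * (((m : ℚ) + 31) * C) * ((m : ℚ) + 28) =
      2 * ((m : ℚ) + 29) * ((m : ℚ) + 26) * (13 * P * ((m : ℚ) + 28) - 3 * ((m : ℚ) + 26) * (19 * (m : ℚ) + 763) * C) +
      3 * C * (2 * ((m : ℚ) + 29) * ((m : ℚ) + 26) * ((m : ℚ) + 26) * (19 * (m : ℚ) + 763) -
        ((m : ℚ) + 27) * (19 * (m : ℚ) + 782) * ((m : ℚ) + 31) * ((m : ℚ) + 28)) := by ring
  linarith [h1, h2, key]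

/-- **The tail inequality** in the form `n = m + 30`. -/
theorem tail_twoone_aux (m : ℕ) :
    3 * ((m : ℚ) + 26) * (19 * (m : ℚ) + 763) * (((m + 30).choose 5 : ℕ) : ℚ) ≤
      13 * 2 ^ (m + 25) * ((m : ℚ) + 28) := by
  induction m with
  | zero => norm_num [Nat.choose_eq_descFactorial_div_factorial, Nat.descFactorial, Nat.factorial]
  | succ m ih =>
    have hC : (((m + 31).choose 5 : ℕ) : ℚ) * ((m : ℚ) + 26) = ((m : ℚ) + 31) * (((m + 30).choose 5 : ℕ) : ℚ) := by
      have := Nat.choose_mul_succ_eq (m + 30) 5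
      rw [show m + 30 + 1 = m + 31 by omega, show m + 31 - 5 = m + 26 by omega] at this
      have this' : (((m + 31).choose 5 : ℕ) : ℚ) * ((m + 26 : ℕ) : ℚ) =
          (((m + 30).choose 5 : ℕ) : ℚ) * ((m + 31 : ℕ) : ℚ) := by
        exact_mod_cast this.symm
      push_cast at this'
      linarith
    have hC0 : (0 : ℚ) ≤ (((m + 30).choose 5 : ℕ) : ℚ) := Nat.cast_nonneg _
    have step := tail_twoone_step m _ _ _ hC0 hC ih
    have e1 : ((m + 1 : ℕ) : ℚ) = (m : ℚ) + 1 := by push_cast; ring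
    have e2 : (2 : ℚ) ^ (m + 1 + 25) = 2 * 2 ^ (m + 25) := by ring
    have e3 : m + 1 + 30 = m + 31 := by omega
    rw [e1, e2, e3]
    refine le_of_eq_of_le (by ring) (le_trans step (le_of_eq (by ring)))

/-- **The tail `n ≥ 30`**: the single middle term `j = ⌊(n−5)/2⌋` of the count sum is `≥ 1`. -/
theorem countSum_twoone_tail {n : ℕ} (hn : 30 ≤ n) :
    1 ≤ countSum n 5 4 (13 / 216 : ℚ) ((19 * (n : ℚ) + 193) / (72 * ((n : ℚ) - 2))) (fun s => (cntSeries 5 s [2] : ℚ)) := by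
  have hEpos : (0 : ℚ) < (19 * (n : ℚ) + 193) / (72 * ((n : ℚ) - 2)) := excess_twoone_pos (by omega)
  have hNpos : (0 : ℚ) < ((n : ℚ) - 2) := by
    have : (30 : ℚ) ≤ (n : ℚ) := by exact_mod_cast hn
    linarith
  set j₀ := (n - 5) / 2 with hj₀
  have hj₀mem : j₀ ∈ Finset.Icc 1 (n - 5) := by rw [Finset.mem_Icc]; omega
  have hcj : DGenP.cjG n 5 4 j₀ (13 / 216 : ℚ) = 13 / 216 := by
    unfold DGenP.cjG; rw [if_pos (by omega)]
  have hterm_nonneg : ∀ j ∈ Finset.Icc 1 (n - 5), (0 : ℚ) ≤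
      ((n - 5).choose j : ℚ) * (DGenP.cjG n 5 4 j (13 / 216 : ℚ) /
        ((cntSeries 5 (j + 5) [2] : ℚ) * ((19 * (n : ℚ) + 193) / (72 * ((n : ℚ) - 2))))) := by
    intro j _
    apply mul_nonneg (by positivity)
    apply div_nonneg
    · unfold DGenP.cjG; split_ifs <;> norm_num
    · exact mul_nonneg (by positivity) hEpos.le
  have hsingle := Finset.single_le_sum hterm_nonneg hj₀mem
  unfold countSum
  refine le_trans ?_ hsingle
  rw [hcj]
  have hcntpos : (0 : ℚ) < (cntSeries 5 (j₀ + 5) [2] : ℚ) := cntSeries_twoone_pos (by omega)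
  rw [mul_div_assoc', le_div_iff₀ (mul_pos hcntpos hEpos)]
  have h1 : (2 : ℚ) ^ (n - 5) ≤ ((n : ℚ) - 4) * ((n - 5).choose j₀ : ℚ) := by
    have := two_pow_le_succ_mul_choose_middle (n - 5)
    have h' : ((2 ^ (n - 5) : ℕ) : ℚ) ≤ (((n - 5 + 1) * (n - 5).choose ((n - 5) / 2) : ℕ) : ℚ) := by
      exact_mod_cast this
    push_cast at h'
    rw [Nat.cast_sub (by omega : 5 ≤ n)] at h'
    push_cast at h'
    rw [hj₀]
    linarith
  have h2 : (cntSeries 5 (j₀ + 5) [2] : ℚ) ≤ (n.choose 5 : ℚ) := by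
    have ha := cntSeries_twoone_le_choose (s := j₀ + 5) (by omega)
    have hb : (j₀ + 5).choose 5 ≤ n.choose 5 := Nat.choose_le_choose 5 (by omega)
    exact_mod_cast ha.trans hb
  have h3 : 3 * ((n : ℚ) - 4) * (19 * (n : ℚ) + 193) * (n.choose 5 : ℚ) ≤
      13 * 2 ^ (n - 5) * ((n : ℚ) - 2) := by
    obtain ⟨m, rfl⟩ : ∃ m, n = m + 30 := ⟨n - 30, by omega⟩
    have := tail_twoone_aux m
    rw [show m + 30 - 5 = m + 25 by omega]
    push_cast
    refine le_of_eq_of_le (by ring) (le_trans this (le_of_eq (by ring)))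
  have hn3 : (0 : ℚ) < (n : ℚ) - 4 := by
    have : (30 : ℚ) ≤ (n : ℚ) := by exact_mod_cast hn
    linarith
  have hcnt' : (cntSeries 5 (j₀ + 5) [2] : ℚ) * ((19 * (n : ℚ) + 193) / (72 * ((n : ℚ) - 2))) ≤ (n.choose 5 : ℚ) * ((19 * (n : ℚ) + 193) / (72 * ((n : ℚ) - 2))) :=
    mul_le_mul_of_nonneg_right h2 hEpos.le
  have hkey : (n.choose 5 : ℚ) * ((19 * (n : ℚ) + 193) / (72 * ((n : ℚ) - 2))) ≤ ((n - 5).choose j₀ : ℚ) * (13 / 216 : ℚ) := by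
    have hAn : (0 : ℚ) < ((n : ℚ) - 4) := by linarith
    have hmulN := mul_le_mul_of_nonneg_right h1 (le_of_lt (show (0 : ℚ) < ((n : ℚ) - 2) by linarith))
    have h5 : 3 * (19 * (n : ℚ) + 193) * (n.choose 5 : ℚ) * ((n : ℚ) - 4) ≤
        13 * ((n - 5).choose j₀ : ℚ) * ((n : ℚ) - 2) * ((n : ℚ) - 4) := by
      nlinarith [h3, hmulN]
    have h6 := le_of_mul_le_mul_right h5 hAn
    rw [mul_div_assoc', div_le_iff₀ (by positivity)]
    linarith [h6]
  calc 1 * ((cntSeries 5 (j₀ + 5) [2] : ℚ) * ((19 * (n : ℚ) + 193) / (72 * ((n : ℚ) - 2)))) = (cntSeries 5 (j₀ + 5) [2] : ℚ) * ((19 * (n : ℚ) + 193) / (72 * ((n : ℚ) - 2))) := one_mul _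
    _ ≤ ((n - 5).choose j₀ : ℚ) * (13 / 216 : ℚ) := hcnt'.trans hkey

end PercRepro.Shadow
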